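import Summits.CriticalPhenomena.CardyFormulaZ2.Theorems.CardyComplexConeEdgePrecompactUFRSScreenedSummation
import Summits.CriticalPhenomena.CardyFormulaZ2.Theorems.CardyComplexConeEdgePrecompactUFRSEvents

/-!
# UFRS for one domain from its three pieces: arm domination by the certificate, decay of its branches
(line `qkz-strip-boundary-arm` of crux `CardyComplexCone.EdgePrecompact`, stmt-CriticalPhenomena-11387;
glue of the corrected road map for the uniform forward response stability "UFRS": module docstrings
of `…EdgePrecompactUFRSAnnulusCrossings.lean` (correction) and `…EdgePrecompactUFRSEvents.lean`
(vocabulary))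

`ufrs_of_pieces` (registered sub-goal, PROVED): for a Dobrushin domain `D`, the UFRS clause at `D`
(verbatim the body of `stub_uniformForwardResponseStability` at `D`) follows from
* the corrected arm domination at `D` — every forward-response failure at a `2ρ`-deep ball of
  radius `ρ ≥ 4η`, shift `‖E.δ w‖ < η`, fine mesh, lies in `ufrsCert E w z (4η) (ρ/2)` for some
  collar point `z` (registered sub-goal `ufrs_armDomination2`, deterministic, general `D`);
* the decay of the FAR branch `P(∃ collar z, ω ∈ ufrsCertFar E w z (4η) (ρ/2)) ≤ ε`
  (`ufrs_screenedCollarDecay`, proved for rectangles as `ufrs_screenedCollarDecay_rect`);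
* the decay of the MARKED ∪ NEAR branches (`ufrs_markedPointDecay`, `…_rect`),
by `ufrs_of_screenedArmDomination` with `A := ufrsCert`, `B := ∅`: the escape clause
`ρ/2 < 256 · 4η` of `ufrsCert` is switched off by `η₁ ≤ ρ/4096`, the rest is a union bound.
Consequently UFRS for axis-parallel rectangles (`ufrs_rect`) is exactly
`ufrs_armDomination2 + ufrs_screenedCollarDecay_rect + ufrs_markedPointDecay_rect`, and the
registered stub itself is `ufrs_armDomination2 + ufrs_screenedCollarDecay + ufrs_markedPointDecay`.

References: G. F. Lawler, O. Schramm, W. Werner, Electron. J. Probab. 7 (2002), Appendix A;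
P. Nolin, Electron. J. Probab. 13 (2008), §4.
-/

namespace Summit.CriticalPhenomena.CardyFormulaZ2.Cruxes.EdgePrecompact.QkzStripBoundaryArm

open MeasureTheory Filter Set Metric
open scoped Topology BigOperators Pointwise
open Literature.Probability.LatticeModels Literature.Probability.Percolation
open Literature.Probability.RandomPlanarGeometry (DobrushinDomain)
open Summit.CriticalPhenomena.CardyFormulaZ2.Theses.CardyComplexCone

noncomputable section

/-- **UFRS at `D` from the three pieces at `D`** (PROVED glue, registered sub-goal `ufrs_of_pieces`):
arm domination by `ufrsCert`, decay of `ufrsCertFar` and of `ufrsCertMarked ∪ ufrsCertNear` give the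
UFRS clause at `D`, by `ufrs_of_screenedArmDomination` with `A := ufrsCert`, `B := ∅`, a union bound,
and `η₁ ≤ ρ/4096` to switch the escape clause off. -/
theorem ufrs_of_pieces : ∀ (D : DobrushinDomain), (∀ (η : ℝ), 0 < η → ∃ δ₀ > (0:ℝ), ∀ E : DiscreteDobrushin, E.Ω = D.carrier → E.IsZdAdmissible → E.δ < δ₀ → ∀ (v w : Site 2) (ρ : ℝ), 4 * η ≤ ρ → 2 * ρ ≤ infDist (meshPoint E.δ v) D.carrierᶜ → ‖meshPoint E.δ w‖ < η → ∀ ω : BondConfig (Site 2), (¬ ∀ a a' : Site 2 × Fin 4, ((E.IsStartCorner a ∧ (shiftData E w).IsStartCorner a') ∨ (a = a' ∧ medialPoint E.δ (cSrc a) ∈ ball (meshPoint E.δ v) ρ ∧ medialPoint E.δ (cTgt a) ∉ ball (meshPoint E.δ v) ρ)) → ∀ n : ℕ, (∀ i < n, medialPoint E.δ (cTgt (cornerOrbit (E.bcBondConfig ω) a i)) ∉ ball (meshPoint E.δ v) ρ ∧ E.IsInnerFace (cFace (cornerOrbit (E.bcBondConfig ω) a (i + 1)))) → medialPoint E.δ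 (cTgt (cornerOrbit (E.bcBondConfig ω) a n)) ∈ ball (meshPoint E.δ v) ρ → ∃ n' : ℕ, (∀ i < n', medialPoint E.δ (cTgt (cornerOrbit ((shiftData E w).bcBondConfig ω) a' i)) ∉ ball (meshPoint E.δ v) ρ ∧ (shiftData E w).IsInnerFace (cFace (cornerOrbit ((shiftData E w).bcBondConfig ω) a' (i + 1)))) ∧ cornerOrbit ((shiftData E w).bcBondConfig ω) a' n' = cornerOrbit (E.bcBondConfig ω) a n ∧ ∑ i ∈ Finset.range n', turnOf ((shiftData E w).bcBondConfig ω) (cornerOrbit ((shiftData E w).bcBondConfig ω) a' i) = ∑ i ∈ Finset.range n, turnOf (E.bcBondConfig ω) (cornerOrbit (E.bcBondConfig ω) a i)) → (∃ z ∈ D.carrier, infDist z D.carrierᶜ < 3 * η ∧ ω ∈ ufrsCert E w z (4 * η) (ρ / 2)) ∨ ω ∈ (∅ : Set (BondConfig (Site 2)))) → (∀ ρ > (0:ℝ), ∀ ε > (0:ℝ), ∃ η₁ > (0:ℝ), ∀ η : ℝ, 0 < η → η < η₁ → ∃ δ₀ > (0:ℝ), ∀ E : DiscreteDobrushin, E.Ω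 = D.carrier → E.IsZdAdmissible → E.δ < δ₀ → ∀ w : Site 2, ‖meshPoint E.δ w‖ < η → (bondPercolation (zdGraph 2) half).real {ω : BondConfig (Site 2) | ∃ z ∈ D.carrier, infDist z D.carrierᶜ < 3 * η ∧ ω ∈ ufrsCertFar E w z (4 * η) (ρ / 2)} ≤ ε) → (∀ ρ > (0:ℝ), ∀ ε > (0:ℝ), ∃ η₁ > (0:ℝ), ∀ η : ℝ, 0 < η → η < η₁ → ∃ δ₀ > (0:ℝ), ∀ E : DiscreteDobrushin, E.Ω = D.carrier → E.IsZdAdmissible → E.δ < δ₀ → ∀ w : Site 2, ‖meshPoint E.δ w‖ < η → (bondPercolation (zdGraph 2) half).real {ω : BondConfig (Site 2) | ∃ z ∈ D.carrier, infDist z D.carrierᶜ < 3 * η ∧ ω ∈ ufrsCertMarked E w z (4 * η) (ρ / 2) ∪ ufrsCertNear E w z (4 * η) (ρ / 2)} ≤ ε) → ∀ (K : Set ℂ), IsCompact K → K ⊆ D.carrier → ∀ ρ > (0:ℝ), cthickening (2 * ρ) K ⊆ D.carrier → ∀ ε > (0:ℝ), ∃ η > (0:ℝ), ∃ δ₀ >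 (0:ℝ), ∀ E : DiscreteDobrushin, E.Ω = D.carrier → E.IsZdAdmissible → E.δ < δ₀ → ∀ v w : Site 2, meshPoint E.δ v ∈ K → ‖meshPoint E.δ w‖ < η → (bondPercolation (zdGraph 2) half).real {ω : BondConfig (Site 2) | ¬ ∀ a a' : Site 2 × Fin 4, ((E.IsStartCorner a ∧ (shiftData E w).IsStartCorner a') ∨ (a = a' ∧ medialPoint E.δ (cSrc a) ∈ ball (meshPoint E.δ v) ρ ∧ medialPoint E.δ (cTgt a) ∉ ball (meshPoint E.δ v) ρ)) → ∀ n : ℕ, (∀ i < n, medialPoint E.δ (cTgt (cornerOrbit (E.bcBondConfig ω) a i)) ∉ ball (meshPoint E.δ v) ρ ∧ E.IsInnerFace (cFace (cornerOrbit (E.bcBondConfig ω) a (i + 1)))) → medialPoint E.δ (cTgt (cornerOrbit (E.bcBondConfig ω) a n)) ∈ ball (meshPoint E.δ v) ρ → ∃ n' : ℕ, (∀ i < n', medialPoint E.δ (cTgt (cornerOrbit ((shiftData E w).bcBondConfig ω) a' i)) ∉ ball (meshPoint E.δ v) ρ ∧ (shiftData E w).IsInnerFace (cFace (cornerOrbit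 ((shiftData E w).bcBondConfig ω) a' (i + 1)))) ∧ cornerOrbit ((shiftData E w).bcBondConfig ω) a' n' = cornerOrbit (E.bcBondConfig ω) a n ∧ ∑ i ∈ Finset.range n', turnOf ((shiftData E w).bcBondConfig ω) (cornerOrbit ((shiftData E w).bcBondConfig ω) a' i) = ∑ i ∈ Finset.range n, turnOf (E.bcBondConfig ω) (cornerOrbit (E.bcBondConfig ω) a i)} ≤ ε := by
  intro D h1 h2 h3
  refine ufrs_of_screenedArmDomination D (fun E w z r R => ufrsCert E w z r R) (fun _ _ _ _ => (∅ : Set (BondConfig (Site 2)))) h1 ?_ ?_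
  · intro ρ hρ ε hε
    obtain ⟨η₂, hη₂, hA⟩ := h2 ρ hρ (ε / 2) (by positivity)
    obtain ⟨η₃, hη₃, hB⟩ := h3 ρ hρ (ε / 2) (by positivity)
    refine ⟨min (min η₂ η₃) (ρ / 4096), lt_min (lt_min hη₂ hη₃) (by positivity), ?_⟩
    intro η hη0 hηlt
    have hη₂' : η < η₂ := lt_of_lt_of_le hηlt ((min_le_left _ _).trans (min_le_left _ _))
    have hη₃' : η < η₃ := lt_of_lt_of_le hηlt ((min_le_left _ _).trans (min_le_right _ _))
    have hηρ : η < ρ / 4096 := lt_of_lt_of_le hηlt (min_le_right _ _)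
    obtain ⟨δ₂, hδ₂, hA'⟩ := hA η hη0 hη₂'
    obtain ⟨δ₃, hδ₃, hB'⟩ := hB η hη0 hη₃'
    refine ⟨min δ₂ δ₃, lt_min hδ₂ hδ₃, ?_⟩
    intro E hEΩ hE hEδ w hw
    have hEδ₂ : E.δ < δ₂ := lt_of_lt_of_le hEδ (min_le_left _ _)
    have hEδ₃ : E.δ < δ₃ := lt_of_lt_of_le hEδ (min_le_right _ _)
    have key := add_le_add (hA' E hEΩ hE hEδ₂ w hw) (hB' E hEΩ hE hEδ₃ w hw)
    refine le_trans ?_ (le_trans key (by linarith))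
    refine le_trans (measureReal_mono ?_) (measureReal_union_le _ _)
    rintro ω ⟨z, hzD, hzc, hcert⟩
    rw [mem_ufrsCert_iff] at hcert
    rcases hcert with ((hesc | hfar) | hmk) | hnear
    · exfalso; linarith
    · exact Or.inl ⟨z, hzD, hzc, hfar⟩
    · exact Or.inr ⟨z, hzD, hzc, Or.inl hmk⟩
    · exact Or.inr ⟨z, hzD, hzc, Or.inr hnear⟩
  · intro ρ _ ε hε
    refine ⟨1, one_pos, fun η _ _ => ⟨1, one_pos, fun E _ _ _ w _ => ?_⟩⟩
    show (bondPercolation (zdGraph 2) half).real (∅ : Set (BondConfig (Site 2))) ≤ ε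
    simp [hε.le]

end

end Summit.CriticalPhenomena.CardyFormulaZ2.Cruxes.EdgePrecompact.QkzStripBoundaryArm
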